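import Mathlib
import HarnessLib.Audit
import Summits.PneNP.PneNP.Theorems.PstarChordBridgeCotree

/-!
# Tools for the no-bridge lemma: leafless families, parities, even-or-cut, fundamental sets (ROUND-24, memo §9 R9 / §13 (P3))

FRONTIER range-avoidance ladder, rung F-N3, ROUND 24 (cell `pnp-ideate`, planner memo `r24/CORE-BOUND-NOTES.md` §1 (bridges), §9 R9, §13 (P3);
restricted-model proof complexity — nothing here bears on `P` versus `NP`).

Pure combinatorics of the XOR multigraph of a set of outputs, used by `PstarNorUnitCover.subset_units`:
`two_le_xpdeg_of_xorClosed` (XOR-closed on a typed instance ⟹ leafless: every XOR vertex has slot-degree `≥ 2`),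
`three_le_card_of_leafless` (a non-empty leafless family has `≥ 3` outputs — pure + simple overlaps), `natCast_xpdeg` / `even_xpdeg_iff`
(slot-degree parities as sums), `exists_even_or_cut` (Fredholm alternative `PstarXorElimination.exists_solution_iff` in the XOR multigraph: an
output lies on an everywhere-even sub-family or crosses some vertex labelling alone), `exists_mem_fundamental_of_even` (an everywhere-even
`Z ⊆ J₀` meets the forest `J₀ ∖ N` only inside the fundamental sets `D e` of its chords `e ∈ Z ∩ N` — reduce `Z` by the even sets `D e + e`
to an even subset of a peelable family, which is empty).
-/

set_option linter.dupNamespace false -- `Summit.PneNP.PneNP.…`: summit = sub-problem name (D-0017 single-conjunct layout)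

open Finset Literature.Computability.Complexity
open Summit.PneNP.PneNP.Theorems.PstarTyped (Typed)
open Summit.PneNP.PneNP.Theorems.PstarSALevel (varSet bdry SimpleOverlap)
open Summit.PneNP.PneNP.Theorems.PstarCoreBound (XorClosed)
open Summit.PneNP.PneNP.Theorems.PstarXorElimination (pdeg exists_solution_iff)
open Summit.PneNP.PneNP.Theorems.PstarXCore (xpair xverts mem_xpair)
open Summit.PneNP.PneNP.Theorems.PstarCentreFree (vars_mem_varSet)
open Summit.PneNP.PneNP.Theorems.PstarChordBridgeTools (xpdeg)
open Summit.PneNP.PneNP.Theorems.PstarChordBridgeFundamental (xpdeg_insert sum_xpdeg)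
open Summit.PneNP.PneNP.Theorems.PstarChordBridgeCotree (Peelable mem_xverts_iff_xpdeg_pos exists_leaf_edge card_lt_card_xverts
  card_xverts_le_of_leafless)

namespace Summit.PneNP.PneNP.Theorems.PstarNorUnitCoverTools

variable {n m : ℕ}

/-! ## Leafless families -/

/-- **XOR-closed ⟹ leafless** on a typed instance: every XOR vertex of `J₀` has slot-degree at least two. -/
theorem two_le_xpdeg_of_xorClosed (I : LocalMap 4 n m) (hT : Typed I) {J₀ : Finset (Fin m)} (hX : XorClosed I J₀) :
    ∀ w ∈ xverts I J₀, 2 ≤ xpdeg I J₀ w := by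
  classical
  intro w hw
  have hpos : 0 < xpdeg I J₀ w := (mem_xverts_iff_xpdeg_pos I J₀ w).1 hw
  by_contra hlt
  have h1 : xpdeg I J₀ w = 1 := by omega
  obtain ⟨j, hj, hwj, huniq⟩ := exists_leaf_edge I h1
  obtain ⟨s, hs, hws⟩ : ∃ s : Fin 4, s.val < 2 ∧ I.vars j s = w := by
    rcases (mem_xpair I).1 hwj with h | h
    · exact ⟨0, by decide, h.symm⟩
    · exact ⟨1, by decide, h.symm⟩
  apply hX j hj s hs
  rw [hws]
  unfold PstarSALevel.bdry
  rw [mem_filter, card_eq_one]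
  refine ⟨mem_univ w, j, ?_⟩
  ext j'
  rw [mem_filter, mem_singleton]
  constructor
  · rintro ⟨hj', hwv⟩
    unfold PstarSALevel.varSet at hwv
    obtain ⟨s', -, hs'⟩ := mem_image.1 hwv
    by_cases hs'2 : s'.val < 2
    · refine huniq j' hj' ((mem_xpair I).2 ?_)
      have h01 : s' = 0 ∨ s' = 1 := by
        have : s'.val = 0 ∨ s'.val = 1 := by omega
        rcases this with h | h
        · exact Or.inl (Fin.ext h)
        · exact Or.inr (Fin.ext h)
      rcases h01 with rfl | rfl
      · exact Or.inl hs'.symm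
      · exact Or.inr hs'.symm
    · exact absurd (hws.trans hs'.symm) (hT j j' s s' hs (by omega))
  · intro h
    rw [h]
    exact ⟨hj, hws ▸ vars_mem_varSet I j s⟩

/-- A vertex of slot-degree `≥ 2` is touched by a second output. -/
theorem exists_ne_of_two_le_xpdeg (I : LocalMap 4 n m) (hI : I.IsPure xorAndPred) {K : Finset (Fin m)} {w : Fin n} (j : Fin m)
    (h2 : 2 ≤ xpdeg I K w) : ∃ j' ∈ K, j' ≠ j ∧ w ∈ xpair I j' := by
  classical
  by_contra h
  push Not at h
  have h01 : I.vars j 0 ≠ I.vars j 1 := fun h => absurd (hI.2 j h) (by decide)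
  have hA : ∀ i ∈ K.filter (fun i => I.vars i 0 = w), i = j := fun i hi => by
    rw [mem_filter] at hi
    by_contra hne
    exact h i hi.1 hne ((mem_xpair I).2 (Or.inl hi.2.symm))
  have hB : ∀ i ∈ K.filter (fun i => I.vars i 1 = w), i = j := fun i hi => by
    rw [mem_filter] at hi
    by_contra hne
    exact h i hi.1 hne ((mem_xpair I).2 (Or.inr hi.2.symm))
  have hA1 : (K.filter fun i => I.vars i 0 = w).card ≤ 1 := card_le_one.2 fun a ha b hb => (hA a ha).trans (hA b hb).symm
  have hB1 : (K.filter fun i => I.vars i 1 = w).card ≤ 1 := card_le_one.2 fun a ha b hb => (hB a ha).trans (hB b hb).symm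
  have h2' : 2 ≤ (K.filter fun i => I.vars i 0 = w).card + (K.filter fun i => I.vars i 1 = w).card := h2
  -- both filters would be `{j}`, putting `w` in both slots of `j`
  have hApos : 0 < (K.filter fun i => I.vars i 0 = w).card := by omega
  have hBpos : 0 < (K.filter fun i => I.vars i 1 = w).card := by omega
  obtain ⟨a, ha⟩ := card_pos.1 hApos
  obtain ⟨b, hb⟩ := card_pos.1 hBpos
  have ha' := (mem_filter.1 ha).2
  have hb' := (mem_filter.1 hb).2
  rw [hA a ha] at ha'
  rw [hB b hb] at hb'
  exact h01 (ha'.trans hb'.symm)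

/-- **A non-empty leafless family has at least three outputs** (pure: two distinct XOR ends; simple overlaps: no two outputs on one pair). -/
theorem three_le_card_of_leafless (I : LocalMap 4 n m) (hI : I.IsPure xorAndPred) (hS : SimpleOverlap I) {K : Finset (Fin m)}
    (hne : K.Nonempty) (hL : ∀ w ∈ xverts I K, 2 ≤ xpdeg I K w) : 3 ≤ K.card := by
  classical
  have hXV := card_xverts_le_of_leafless I hL
  obtain ⟨j, hj⟩ := hne
  have h01 : I.vars j 0 ≠ I.vars j 1 := fun h => absurd (hI.2 j h) (by decide)
  have hcard : (xpair I j).card = 2 := by unfold PstarXCore.xpair; exact card_pair h01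
  have hpair : xpair I j ⊆ xverts I K := fun u hu => by unfold PstarXCore.xverts; exact mem_biUnion.2 ⟨j, hj, hu⟩
  by_contra hlt
  have hxe : xverts I K = xpair I j := (eq_of_subset_of_card_le hpair (by rw [hcard]; omega)).symm
  -- a second output on the vertex `u_j`
  obtain ⟨j', hj', hne', hw⟩ := exists_ne_of_two_le_xpdeg I hI j (hL (I.vars j 0) (hpair ((mem_xpair I).2 (Or.inl rfl))))
  have h01' : I.vars j' 0 ≠ I.vars j' 1 := fun h => absurd (hI.2 j' h) (by decide)
  have hpair' : xpair I j' ⊆ xpair I j := fun u hu => by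
    rw [← hxe]; unfold PstarXCore.xverts; exact mem_biUnion.2 ⟨j', hj', hu⟩
  -- the two outputs share both XOR variables
  have hsub : xpair I j' ⊆ varSet I j ∩ varSet I j' := by
    intro u hu
    rw [mem_inter]
    refine ⟨?_, ?_⟩
    · rcases (mem_xpair I).1 (hpair' hu) with h | h <;> rw [h]
      exacts [vars_mem_varSet I j 0, vars_mem_varSet I j 1]
    · rcases (mem_xpair I).1 hu with h | h <;> rw [h]
      exacts [vars_mem_varSet I j' 0, vars_mem_varSet I j' 1]
  have := (card_le_card hsub).trans (hS j j' hne'.symm)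
  unfold PstarXCore.xpair at this
  rw [card_pair h01'] at this
  omega

/-! ## Slot-degree parities -/

/-- `xpdeg` mod 2 is the sum of the incidence numbers `[u_j = w] + [v_j = w]`. -/
theorem natCast_xpdeg (I : LocalMap 4 n m) (E : Finset (Fin m)) (w : Fin n) :
    ((xpdeg I E w : ℕ) : ZMod 2) = ∑ j ∈ E, ((if I.vars j 0 = w then (1 : ZMod 2) else 0) + (if I.vars j 1 = w then 1 else 0)) := by
  unfold xpdeg pdeg
  rw [sum_add_distrib, Nat.cast_add, card_filter, card_filter, Nat.cast_sum, Nat.cast_sum]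
  congr 1 <;> exact sum_congr rfl fun j _ => by split_ifs <;> simp

/-- Evenness of a slot-degree as a vanishing sum. -/
theorem even_xpdeg_iff (I : LocalMap 4 n m) (E : Finset (Fin m)) (w : Fin n) : Even (xpdeg I E w) ↔ ∑ j ∈ E, ((if I.vars j 0 = w then (1 : ZMod 2) else 0) + (if I.vars j 1 = w then 1 else 0)) = 0 := by
  rw [← natCast_xpdeg, ZMod.natCast_eq_zero_iff_even]

/-! ## Even subgraph or cut -/

/-- **Fredholm alternative in the XOR multigraph**: an output `t ∈ J₀` lies on an everywhere-even sub-family of `J₀`, or some vertex labelling is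
crossed (oddly) by `t` alone among the outputs of `J₀`. -/
theorem exists_even_or_cut (I : LocalMap 4 n m) (J₀ : Finset (Fin m)) {t : Fin m} (_ht : t ∈ J₀) :
    (∃ Z ⊆ J₀, t ∈ Z ∧ ∀ w, Even (xpdeg I Z w)) ∨
    ∃ x : Fin n → ZMod 2, ∀ j ∈ J₀, x (I.vars j 0) + x (I.vars j 1) = if j = t then 1 else 0 := by
  classical
  by_cases h : ∃ Z ⊆ J₀, t ∈ Z ∧ ∀ w, Even (xpdeg I Z w)
  · exact Or.inl h
  right
  push Not at h
  let L : Fin m → (Fin n → ZMod 2) →ₗ[ZMod 2] ZMod 2 := fun j =>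
    LinearMap.proj (R := ZMod 2) (φ := fun _ : Fin n => ZMod 2) (I.vars j 0) + LinearMap.proj (R := ZMod 2) (φ := fun _ : Fin n => ZMod 2) (I.vars j 1)
  have hL : ∀ j (x : Fin n → ZMod 2), L j x = x (I.vars j 0) + x (I.vars j 1) := fun j x => rfl
  obtain ⟨x, hx⟩ := (exists_solution_iff L (fun j => if j = t then (1 : ZMod 2) else 0) J₀).2 (by
    intro D hD hdep
    -- a dependency is an everywhere-even sub-family
    have hev : ∀ w, Even (xpdeg I D w) := by
      intro w
      have e := congrArg (fun f : (Fin n → ZMod 2) →ₗ[ZMod 2] ZMod 2 => f (Pi.single w 1)) hdep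
      simp only [LinearMap.coe_sum, Finset.sum_apply, LinearMap.zero_apply, hL] at e
      rw [even_xpdeg_iff]
      refine Eq.trans (sum_congr rfl fun j _ => ?_) e
      rw [Pi.single_apply, Pi.single_apply]
    have htD : t ∉ D := fun htD => by
      obtain ⟨w, hw⟩ := h D hD htD
      exact hw (hev w)
    rw [sum_ite_eq']
    simp [htD])
  exact ⟨x, fun j hj => by rw [← hL]; exact hx j hj⟩

/-! ## Even sub-families pass through the fundamental sets -/

/-- **An everywhere-even `Z ⊆ J₀` meets the forest only inside the fundamental sets of its chords**: for `t ∈ Z ∖ N` some chord `e ∈ Z ∩ N` has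
`t ∈ D e`.  (`Z` plus the even sets `D e + e`, `e ∈ Z ∩ N`, is an even subset of the peelable `J₀ ∖ N`, hence empty.) -/
theorem exists_mem_fundamental_of_even (I : LocalMap 4 n m) {J₀ N : Finset (Fin m)} {D : Fin m → Finset (Fin m)}
    (hP : Peelable I (J₀ \ N)) (hD : ∀ e ∈ N, D e ⊆ J₀ \ N) (hDeven : ∀ e ∈ N, ∀ w, Even (xpdeg I (insert e (D e)) w))
    {Z : Finset (Fin m)} (hZ : Z ⊆ J₀) (hZeven : ∀ w, Even (xpdeg I Z w)) {t : Fin m} (htZ : t ∈ Z) (htN : t ∉ N) :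
    ∃ e ∈ Z ∩ N, t ∈ D e := by
  classical
  by_contra hno
  push Not at hno
  -- the reduced family
  set χ : Fin m → ZMod 2 := fun j => (if j ∈ Z then 1 else 0) + ∑ e ∈ Z ∩ N, (if j ∈ D e then 1 else 0) with hχ
  set Z' : Finset (Fin m) := (J₀ \ N).filter fun j => χ j = 1 with hZ'
  have h01 : ∀ a : ZMod 2, a = 0 ∨ a = 1 := by decide
  -- it is everywhere even
  have heven : ∀ w, Even (xpdeg I Z' w) := by
    intro w
    rw [even_xpdeg_iff]
    -- `Σ_{Z'} ι = Σ_{J₀∖N} χ·ι` (`ι_j(w) = [u_j = w] + [v_j = w]`)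
    have step1 : ∑ j ∈ Z', ((if I.vars j 0 = w then (1 : ZMod 2) else 0) + (if I.vars j 1 = w then 1 else 0)) = ∑ j ∈ J₀ \ N, χ j * ((if I.vars j 0 = w then (1 : ZMod 2) else 0) + (if I.vars j 1 = w then 1 else 0)) := by
      rw [hZ', sum_filter]
      refine sum_congr rfl fun j _ => ?_
      rcases h01 (χ j) with h | h <;> simp [h]
    -- the `Z`-part
    have step2 : ∑ j ∈ J₀ \ N, (if j ∈ Z then (1 : ZMod 2) else 0) * ((if I.vars j 0 = w then (1 : ZMod 2) else 0) + (if I.vars j 1 = w then 1 else 0)) = ∑ j ∈ Z \ N, ((if I.vars j 0 = w then (1 : ZMod 2) else 0) + (if I.vars j 1 = w then 1 else 0)) := by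
      rw [← sum_filter_of_ne (s := J₀ \ N) (p := fun j => j ∈ Z) (fun j _ hne => by by_contra h; simp [h] at hne)]
      have : (J₀ \ N).filter (fun j => j ∈ Z) = Z \ N := by
        ext j; simp only [mem_filter, mem_sdiff]; constructor
        · rintro ⟨⟨-, hjN⟩, hjZ⟩; exact ⟨hjZ, hjN⟩
        · rintro ⟨hjZ, hjN⟩; exact ⟨⟨hZ hjZ, hjN⟩, hjZ⟩
      rw [this]
      exact sum_congr rfl fun j hj => by simp [(mem_sdiff.1 hj).1]
    -- the `D e`-parts
    have step3 : ∀ e ∈ Z ∩ N, ∑ j ∈ J₀ \ N, (if j ∈ D e then (1 : ZMod 2) else 0) * ((if I.vars j 0 = w then (1 : ZMod 2) else 0) + (if I.vars j 1 = w then 1 else 0)) = ((if I.vars e 0 = w then (1 : ZMod 2) else 0) + (if I.vars e 1 = w then 1 else 0)) := by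
      intro e he
      have heN : e ∈ N := (mem_inter.1 he).2
      rw [← sum_filter_of_ne (s := J₀ \ N) (p := fun j => j ∈ D e) (fun j _ hne => by by_contra h; simp [h] at hne)]
      have : (J₀ \ N).filter (fun j => j ∈ D e) = D e := by
        ext j; simp only [mem_filter]; constructor
        · exact fun h => h.2
        · exact fun h => ⟨hD e heN h, h⟩
      rw [this]
      have heD : e ∉ D e := fun h => (mem_sdiff.1 (hD e heN h)).2 heN
      have hsum : ∑ j ∈ insert e (D e), ((if I.vars j 0 = w then (1 : ZMod 2) else 0) + (if I.vars j 1 = w then 1 else 0)) = 0 := (even_xpdeg_iff I _ w).1 (hDeven e heN w)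
      rw [sum_insert heD] at hsum
      have : ∑ j ∈ D e, ((if I.vars j 0 = w then (1 : ZMod 2) else 0) + (if I.vars j 1 = w then 1 else 0)) = ((if I.vars e 0 = w then (1 : ZMod 2) else 0) + (if I.vars e 1 = w then 1 else 0)) := by
        have h2 : ∀ a b : ZMod 2, a + b = 0 → b = a := by decide
        exact h2 _ _ hsum
      rw [← this]
      exact sum_congr rfl fun j hj => by simp [hj]
    -- assemble
    rw [step1]
    have : ∑ j ∈ J₀ \ N, χ j * ((if I.vars j 0 = w then (1 : ZMod 2) else 0) + (if I.vars j 1 = w then 1 else 0)) =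
        ∑ j ∈ J₀ \ N, (if j ∈ Z then (1 : ZMod 2) else 0) * ((if I.vars j 0 = w then (1 : ZMod 2) else 0) + (if I.vars j 1 = w then 1 else 0)) +
        ∑ e ∈ Z ∩ N, ∑ j ∈ J₀ \ N, (if j ∈ D e then (1 : ZMod 2) else 0) * ((if I.vars j 0 = w then (1 : ZMod 2) else 0) + (if I.vars j 1 = w then 1 else 0)) := by
      rw [sum_comm, ← sum_add_distrib]
      refine sum_congr rfl fun j _ => ?_
      rw [hχ, add_mul, sum_mul]
    rw [this, step2, sum_congr rfl step3, ← sum_union (disjoint_sdiff_inter Z N), sdiff_union_inter]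
    exact (even_xpdeg_iff I Z w).1 (hZeven w)
  -- so it is empty
  have hempty : Z' = ∅ := by
    by_contra hne
    obtain ⟨w, hw⟩ := hP Z' (filter_subset _ _) (nonempty_iff_ne_empty.2 hne)
    have := heven w
    rw [hw] at this
    exact absurd this (by decide)
  -- but it contains `t`
  have htZ' : t ∈ Z' := by
    rw [hZ', mem_filter]
    refine ⟨mem_sdiff.2 ⟨hZ htZ, htN⟩, ?_⟩
    rw [hχ]
    simp only [htZ, if_true]
    rw [sum_eq_zero fun e he => by simp [hno e he], add_zero]
  rw [hempty] at htZ'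
  exact notMem_empty t htZ'

end Summit.PneNP.PneNP.Theorems.PstarNorUnitCoverTools
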